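import Summits.CriticalPhenomena.PercolationContinuityZ3.Theorems.SoloBlindShellCriterion
import Literature.Probability.Percolation.InequalitiesProofs
import HarnessLib

/-!
# The box-crossing criterion: thin-way crossings bounded away from one force `θ = 0`

Solo-blind generation 11, `PercolationContinuityZ3` (target `θ(p_c) = 0` on `ℤ³`); companion to
`SoloBlindShellCriterion.lean`.

Fix an integer `a ≥ 2`.  For `n ≥ 1`, a coordinate `i` and an orientation `±`, the SLAB PIECE
`T^a_{i,±}(n)` of the annulus `Λ_{an} ∖ Λ_{n-1}` is the flat box `{x ∈ Λ_{an} : n ≤ ±x_i}`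
(side lengths `2an+1` in `d-1` directions and `(a-1)n+1` in direction `i`; e.g. `[-2n, 2n]² × [n, 2n]`
on `ℤ³` for `a = 2`; aspect ratio `2a : ⋯ : 2a : (a-1)`, which exceeds and tends to `2 : ⋯ : 2 : 1`
as `a → ∞`), and `slabCrossing d a n i ±` is the event that `T^a_{i,±}(n)` is crossed THE THIN WAY:
an open path inside `T^a_{i,±}(n)` joins its inner face `{±x_i = n}` to its outer face `{±x_i = an}`.
This file proves, for Bernoulli bond percolation at any density `p` on `ℤ^d`:

* `exists_slabCrossing_of_shellCrossing`: for `ω ⊆ E(ℤ^d)`, an open crossing of the annulus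
  `n ≤ ‖x‖_∞ ≤ an` (the event `shellCrossing d (n-1) (an)`) contains a thin-way crossing of one of
  the `2d` slab pieces — follow the crossing from its last visit to `{±x_i ≤ n}`, where `±x_i = an`
  at its endpoint;
* `real_compl_shellCrossing_ge`: hence, by the Harris–FKG inequality for the `2d` decreasing
  events "`T^a_{i,±}(n)` is not crossed" (`prod_real_le_real_biInter`), if every thin-way crossing
  probability is `≤ 1 - c'` then the annulus is NOT crossed with probability `≥ c'^{2d}`;
* `theta_eq_zero_of_slabCrossings`, `percolationContinuity_of_slabCrossings`,
  `percolationContinuityZ3_of_slabCrossings`: combined with the shell criterion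
  (`theta_eq_zero_of_shells`, at the scales `n = (a+1)^k`), IF there are `a ≥ 2` and `c' > 0` such
  that for all `n ≥ 1` and all `2d` orientations `P_p(T^a_{i,±}(n) is crossed the thin way) ≤ 1 - c'`,
  THEN `θ(p) = 0`; at `p = p_c` this is `PercolationContinuity d`, and `d = 3` gives `θ(p_c) = 0`
  on `ℤ³`.

Reading. The hypothesis at `p_c` — thin-way crossing probabilities of boxes of ONE fixed shape of
aspect ratio `> 2` bounded away from `1` (the `2d` orientations have equal probability by the
symmetries of `ℤ^d`; the hypothesis is stated for all of them to keep the file symmetry-free) — is an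
instance of the postulate of Borgs–Chayes–Kesten–Spencer (1999) that critical crossing probabilities
of boxes of fixed shape are bounded away from `1`, expected to hold exactly below the upper critical
dimension and open on `ℤ³`. The file does not claim it; it records, kernel-checked, that this single
box-crossing bound at `p_c` already decides `θ(p_c) = 0`.

References: G. Grimmett, Percolation (2nd ed., 1999), Thm. 2.4 and (2.7) (Harris–FKG for
decreasing events, iterated), §11.7 (the planar RSW mechanism this hypothesis replaces);
C. Borgs, J. T. Chayes, H. Kesten, J. Spencer, Random Structures Algorithms 15 (1999), 368–413;
B. Bollobás, O. Riordan, Percolation (2006), Ch. 7 (context for the hypothesis only).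
Tree inputs: `harris_fkg_lower` (`InequalitiesProofs.lean`), `PathIn.last_exit`,
`DCT16.abs_sub_le_one_of_adj`, and `SoloBlindShellCriterion.lean`.
-/

namespace Summit.CriticalPhenomena.PercolationContinuityZ3.Theorems

open MeasureTheory ProbabilityTheory Filter Topology
open Literature.Probability.LatticeModels Literature.Probability.Percolation
open Literature.Probability.Percolation.DCT16

variable {d : ℕ}

/-! ### Oriented coordinates, slab pieces and their thin-way crossings -/

/-- The oriented coordinate `±z`: `z` if `up`, `-z` otherwise. -/
def sgnCoord (up : Bool) (z : ℤ) : ℤ := if up then z else -z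

/-- Every integer of absolute value `m` equals `m` in one of the two orientations. -/
theorem exists_sgnCoord_eq {z : ℤ} {m : ℕ} (h : z.natAbs = m) : ∃ up, sgnCoord up z = m := by
  rcases le_or_gt 0 z with h0 | h0
  · exact ⟨true, by simp only [sgnCoord, if_true]; omega⟩
  · exact ⟨false, by simp only [sgnCoord, Bool.false_eq_true, if_false]; omega⟩

/-- In a box `Λ_m` every oriented coordinate is at most `m`. -/
theorem sgnCoord_le_of_mem_box {m : ℕ} {x : Site d} (hx : x ∈ box d m) (i : Fin d) (up : Bool) :
    sgnCoord up (x i) ≤ m := by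
  have := (mem_box.1 hx) i
  cases up
  · simp only [sgnCoord, Bool.false_eq_true, if_false]; omega
  · simp only [sgnCoord, if_true]; omega

/-- Along an edge of `ℤ^d` an oriented coordinate increases by at most `1`. -/
theorem sgnCoord_le_add_one_of_adj {x y : Site d} (h : (zdGraph d).Adj x y) (i : Fin d)
    (up : Bool) : sgnCoord up (y i) ≤ sgnCoord up (x i) + 1 := by
  have := abs_sub_le_one_of_adj h i
  rw [abs_le] at this
  cases up
  · simp only [sgnCoord, Bool.false_eq_true, if_false]; omega
  · simp only [sgnCoord, if_true]; omega

/-- **The slab piece** `T^a_{i,±}(n) = {x ∈ Λ_{an} : n ≤ ±x_i}` of the annulus `Λ_{an} ∖ Λ_{n-1}`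
(on `ℤ³` with `a = 2`: the flat boxes `[-2n, 2n]² × [n, 2n]` and their images under the symmetries
of the cube). -/
noncomputable def slabPiece (d a n : ℕ) (i : Fin d) (up : Bool) : Finset (Site d) :=
  (box d (a * n)).filter fun x => (n : ℤ) ≤ sgnCoord up (x i)

/-- The inner face `{x ∈ T^a_{i,±}(n) : ±x_i = n}` of the slab piece. -/
noncomputable def slabInnerFace (d a n : ℕ) (i : Fin d) (up : Bool) : Finset (Site d) :=
  (slabPiece d a n i up).filter fun x => sgnCoord up (x i) = n

/-- The outer face `{x ∈ T^a_{i,±}(n) : ±x_i = an}` of the slab piece. -/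
noncomputable def slabOuterFace (d a n : ℕ) (i : Fin d) (up : Bool) : Finset (Site d) :=
  (slabPiece d a n i up).filter fun x => sgnCoord up (x i) = (a * n : ℕ)

/-- Membership in the slab piece. -/
theorem mem_slabPiece {a n : ℕ} {i : Fin d} {up : Bool} {x : Site d} :
    x ∈ slabPiece d a n i up ↔ x ∈ box d (a * n) ∧ (n : ℤ) ≤ sgnCoord up (x i) :=
  Finset.mem_filter

/-- Membership in the inner face. -/
theorem mem_slabInnerFace {a n : ℕ} {i : Fin d} {up : Bool} {x : Site d} :
    x ∈ slabInnerFace d a n i up ↔ x ∈ slabPiece d a n i up ∧ sgnCoord up (x i) = n :=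
  Finset.mem_filter

/-- Membership in the outer face. -/
theorem mem_slabOuterFace {a n : ℕ} {i : Fin d} {up : Bool} {x : Site d} :
    x ∈ slabOuterFace d a n i up ↔ x ∈ slabPiece d a n i up ∧ sgnCoord up (x i) = (a * n : ℕ) :=
  Finset.mem_filter

/-- **The thin-way crossing event** of the slab piece `T^a_{i,±}(n)`: some site of its inner face
is joined to some site of its outer face by an open path inside `T^a_{i,±}(n)`. -/
def slabCrossing (d a n : ℕ) (i : Fin d) (up : Bool) : Set (BondConfig (Site d)) :=
  ⋃ x ∈ slabInnerFace d a n i up, ⋃ y ∈ slabOuterFace d a n i up,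
    openConnIn (↑(slabPiece d a n i up) : Set (Site d)) x y

/-- Membership in `slabCrossing`, in terms of open paths. -/
theorem mem_slabCrossing {a n : ℕ} {i : Fin d} {up : Bool} {ω : BondConfig (Site d)} :
    ω ∈ slabCrossing d a n i up ↔ ∃ x ∈ slabInnerFace d a n i up, ∃ y ∈ slabOuterFace d a n i up,
      PathIn (openGraph ω) (↑(slabPiece d a n i up) : Set (Site d)) x y := by
  simp only [slabCrossing, Set.mem_iUnion, exists_prop, mem_openConnIn_iff_pathIn]

/-- `slabCrossing` is increasing. -/
theorem isUpperSet_slabCrossing (d a n : ℕ) (i : Fin d) (up : Bool) :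
    IsUpperSet (slabCrossing d a n i up) :=
  isUpperSet_iUnion₂ fun x _ => isUpperSet_iUnion₂ fun y _ => isUpperSet_openConnIn _ x y

/-- `slabCrossing` is determined by the pairs of sites of the slab piece. -/
theorem determinedBy_slabCrossing (d a n : ℕ) (i : Fin d) (up : Bool) :
    DeterminedBy (slabCrossing d a n i up) (↑((slabPiece d a n i up).sym2) : Set (Sym2 (Site d))) :=
  DeterminedBy.iUnion fun x => DeterminedBy.iUnion fun _ => DeterminedBy.iUnion fun y =>
    DeterminedBy.iUnion fun _ => determinedBy_openConnIn _ x y (by rw [Finset.coe_sym2])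

/-- `slabCrossing` is measurable. -/
theorem measurableSet_slabCrossing (d a n : ℕ) (i : Fin d) (up : Bool) :
    MeasurableSet (slabCrossing d a n i up) :=
  (determinedBy_slabCrossing d a n i up).measurableSet_of_finset

/-! ### An annulus crossing crosses a slab piece the thin way -/

/-- **Geometric reduction.** For `ω ⊆ E(ℤ^d)`, `a ≥ 2` and `n ≥ 1`, if the annulus
`n ≤ ‖x‖_∞ ≤ an` is crossed (`shellCrossing d (n-1) (an)`), then some slab piece `T^a_{i,±}(n)` is
crossed the thin way: the crossing ends at a site with `±y_i = an` for some `i, ±`; after its last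
visit to `{±x_i ≤ n}` it runs inside `T^a_{i,±}(n)` from the inner face to the outer face. -/
theorem exists_slabCrossing_of_shellCrossing {a n : ℕ} (ha : 2 ≤ a) (hn : 1 ≤ n)
    {ω : BondConfig (Site d)} (hω : ω ⊆ (zdGraph d).edgeSet)
    (h : ω ∈ shellCrossing d (n - 1) (a * n)) : ∃ i up, ω ∈ slabCrossing d a n i up := by
  rw [mem_shellCrossing, Nat.sub_add_cancel hn] at h
  obtain ⟨b, hb, y, hy, hp⟩ := h
  obtain ⟨i, hi⟩ := exists_natAbs_eq_of_mem_innerBoundary_box hy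
  obtain ⟨up, hyi⟩ := exists_sgnCoord_eq hi
  have hyan : y ∈ box d (a * n) := (mem_innerBoundary_iff.1 hy).1
  have hlt : n < a * n := by
    have : 2 * n ≤ a * n := Nat.mul_le_mul_right n ha
    omega
  have hlt' : (n : ℤ) < ((a * n : ℕ) : ℤ) := by exact_mod_cast hlt
  -- last visit of the crossing to the region `{±x_i ≤ n}`
  set C : Set (Site d) := {x | sgnCoord up (x i) ≤ n} with hC
  have hbC : b ∈ C := sgnCoord_le_of_mem_box (mem_shell.1 hb).1 i up
  have hyC : y ∉ C := by
    show ¬ sgnCoord up (y i) ≤ n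
    omega
  obtain ⟨x, c, hxC, hxS, hcC, hxc, hp'⟩ := hp.last_exit hbC hyC
  have h1 := sgnCoord_le_add_one_of_adj (adj_of_openGraph_adj hω hxc) i up
  have hxC' : sgnCoord up (x i) ≤ n := hxC
  have hcC' : ¬ sgnCoord up (c i) ≤ n := hcC
  have hxi : sgnCoord up (x i) = n := by omega
  -- everything after `x` lies in the slab piece
  have hsub : (↑(shell d (n - 1) (a * n)) : Set (Site d)) \ C ⊆ ↑(slabPiece d a n i up) := by
    rintro z ⟨hzS, hzC⟩
    have hzC' : ¬ sgnCoord up (z i) ≤ n := hzC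
    exact Finset.mem_coe.2 (mem_slabPiece.2 ⟨(mem_shell.1 (Finset.mem_coe.1 hzS)).1, by omega⟩)
  have hxT : x ∈ slabPiece d a n i up :=
    mem_slabPiece.2 ⟨(mem_shell.1 (Finset.mem_coe.1 hxS)).1, by omega⟩
  have hcT : c ∈ (↑(slabPiece d a n i up) : Set (Site d)) := hsub hp'.left_mem
  refine ⟨i, up, mem_slabCrossing.2 ⟨x, mem_slabInnerFace.2 ⟨hxT, hxi⟩, y,
    mem_slabOuterFace.2 ⟨mem_slabPiece.2 ⟨hyan, by omega⟩, hyi⟩, ?_⟩⟩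
  exact (PathIn.of_adj (Finset.mem_coe.2 hxT) hcT hxc).trans (hp'.mono hsub)

/-! ### Harris–FKG over the `2d` pieces -/

/-- **Iterated Harris–FKG for decreasing events** (Grimmett 1999, (2.7)): for finitely many
decreasing measurable events, `∏ P_p(A_k) ≤ P_p(⋂ A_k)`. -/
theorem prod_real_le_real_biInter {ι : Type*} (p : unitInterval) (s : Finset ι)
    (A : ι → Set (BondConfig (Site d))) (hA : ∀ k, IsLowerSet (A k))
    (hAm : ∀ k, MeasurableSet (A k)) :
    ∏ k ∈ s, (bondPercolation (zdGraph d) p).real (A k) ≤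
      (bondPercolation (zdGraph d) p).real (⋂ k ∈ s, A k) := by
  classical
  refine Finset.induction_on s (by simp) fun a s ha ih => ?_
  rw [Finset.prod_insert ha, Finset.set_biInter_insert]
  refine le_trans (mul_le_mul_of_nonneg_left ih measureReal_nonneg) ?_
  exact harris_fkg_lower (zdGraph d) p (hA a) (isLowerSet_iInter₂ fun k _ => hA k) (hAm a)
    (Finset.measurableSet_biInter s fun k _ => hAm k)

/-- **From box crossings to annulus disconnection.** If `a ≥ 2`, `n ≥ 1` and every thin-way
crossing probability `P_p(T^a_{i,±}(n) crossed)` is at most `1 - c'` (`c' ≥ 0`), then the annulus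
`n ≤ ‖x‖_∞ ≤ an` fails to be crossed with probability at least `c'^{2d}`. -/
theorem real_compl_shellCrossing_ge (p : unitInterval) {c' : ℝ} (hc' : 0 ≤ c') {a n : ℕ}
    (ha : 2 ≤ a) (hn : 1 ≤ n)
    (h : ∀ (i : Fin d) (up : Bool),
      (bondPercolation (zdGraph d) p).real (slabCrossing d a n i up) ≤ 1 - c') :
    c' ^ (2 * d) ≤ (bondPercolation (zdGraph d) p).real (shellCrossing d (n - 1) (a * n))ᶜ := by
  classical
  have hk : ∀ k : Fin d × Bool,
      c' ≤ (bondPercolation (zdGraph d) p).real (slabCrossing d a n k.1 k.2)ᶜ := fun k => by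
    rw [probReal_compl_eq_one_sub (measurableSet_slabCrossing d a n k.1 k.2)]
    linarith [h k.1 k.2]
  calc c' ^ (2 * d) = ∏ _k : Fin d × Bool, c' := by
        simp [Finset.prod_const, Finset.card_univ, Fintype.card_prod, Fintype.card_bool, mul_comm]
    _ ≤ ∏ k : Fin d × Bool, (bondPercolation (zdGraph d) p).real (slabCrossing d a n k.1 k.2)ᶜ :=
        Finset.prod_le_prod (fun k _ => hc') fun k _ => hk k
    _ ≤ (bondPercolation (zdGraph d) p).real
          (⋂ k ∈ (Finset.univ : Finset (Fin d × Bool)), (slabCrossing d a n k.1 k.2)ᶜ) :=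
        prod_real_le_real_biInter p _ _ (fun k => (isUpperSet_slabCrossing d a n k.1 k.2).compl)
          fun k => (measurableSet_slabCrossing d a n k.1 k.2).compl
    _ ≤ (bondPercolation (zdGraph d) p).real (shellCrossing d (n - 1) (a * n))ᶜ := by
        refine real_mono_of_forall_subset_edgeSet (zdGraph d) p fun ω hω hωF hωS => ?_
        obtain ⟨i, up, hi⟩ := exists_slabCrossing_of_shellCrossing ha hn hω hωS
        simp only [Set.mem_iInter] at hωF
        exact hωF (i, up) (Finset.mem_univ _) hi

/-! ### Consequences: `θ = 0` -/

/-- **Annulus form of the shell criterion at a general density**: if `a ≥ 2` and for every `n ≥ 1`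
the annulus `n ≤ ‖x‖_∞ ≤ an` fails to be crossed with `P_p`-probability at least `c > 0`, then
`θ(p) = 0` (disjoint annuli at the scales `n = (a+1)^k`; `theta_eq_zero_of_shells`). -/
theorem theta_eq_zero_of_annuli (p : unitInterval) {c : ℝ} (hc : 0 < c) {a : ℕ} (ha : 2 ≤ a)
    (h : ∀ n, 1 ≤ n →
      c ≤ (bondPercolation (zdGraph d) p).real (shellCrossing d (n - 1) (a * n))ᶜ) :
    theta (zdGraph d) 0 p = 0 := by
  refine theta_eq_zero_of_shells p hc (m := fun k => (a + 1) ^ k - 1) (M := fun k => a * (a + 1) ^ k)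
    (fun k => ?_) (fun k => ?_) (fun k => h ((a + 1) ^ k) (Nat.one_le_pow _ _ (by omega)))
  · show (a + 1) ^ k - 1 < a * (a + 1) ^ k
    have h3 : 1 ≤ (a + 1) ^ k := Nat.one_le_pow k (a + 1) (by omega)
    have h4 : (a + 1) ^ k ≤ a * (a + 1) ^ k := Nat.le_mul_of_pos_left _ (by omega)
    generalize (a + 1) ^ k = t at h3 h4 ⊢
    generalize a * t = u at h4 ⊢
    omega
  · show a * (a + 1) ^ k ≤ (a + 1) ^ (k + 1) - 1
    have h3 : 1 ≤ (a + 1) ^ k := Nat.one_le_pow k (a + 1) (by omega)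
    rw [pow_succ, mul_comm ((a + 1) ^ k), add_mul, one_mul]
    generalize (a + 1) ^ k = t at h3 ⊢
    generalize a * t = u
    omega

/-- **The box-crossing criterion.** If there are `a ≥ 2` and `c' > 0` such that for every `n ≥ 1`
and each of the `2d` orientations the flat box `T^a_{i,±}(n)` is crossed the thin way with
`P_p`-probability at most `1 - c'`, then `θ(p) = 0`. -/
theorem theta_eq_zero_of_slabCrossings (p : unitInterval) {c' : ℝ} (hc' : 0 < c') {a : ℕ}
    (ha : 2 ≤ a)
    (h : ∀ n, 1 ≤ n → ∀ (i : Fin d) (up : Bool),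
      (bondPercolation (zdGraph d) p).real (slabCrossing d a n i up) ≤ 1 - c') :
    theta (zdGraph d) 0 p = 0 :=
  theta_eq_zero_of_annuli p (pow_pos hc' (2 * d)) ha fun n hn =>
    real_compl_shellCrossing_ge p hc'.le ha hn (h n hn)

/-- **Continuity from box crossings**: at `p = p_c(ℤ^d)`, thin-way crossing probabilities of the
boxes `T^a_{i,±}(n)` (one fixed `a ≥ 2`) bounded away from `1` imply `θ(p_c) = 0`. -/
theorem percolationContinuity_of_slabCrossings {c' : ℝ} (hc' : 0 < c') {a : ℕ} (ha : 2 ≤ a)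
    (h : ∀ n, 1 ≤ n → ∀ (i : Fin d) (up : Bool),
      (bondPercolation (zdGraph d) (criticalProbI d)).real (slabCrossing d a n i up) ≤ 1 - c') :
    PercolationContinuity d :=
  theta_eq_zero_of_slabCrossings (criticalProbI d) hc' ha h

/-- **`θ(p_c) = 0` on `ℤ³` from box crossings**: if, for one fixed `a ≥ 2`, the flat boxes
`[-an, an]² × [n, an]` (and their images under the symmetries of the cube) are crossed the thin way
at `p_c(ℤ³)` with probability at most `1 - c' < 1`, uniformly in `n ≥ 1`, then `θ(p_c) = 0` on `ℤ³`. -/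
theorem percolationContinuityZ3_of_slabCrossings {c' : ℝ} (hc' : 0 < c') {a : ℕ} (ha : 2 ≤ a)
    (h : ∀ n, 1 ≤ n → ∀ (i : Fin 3) (up : Bool),
      (bondPercolation (zdGraph 3) (criticalProbI 3)).real (slabCrossing 3 a n i up) ≤ 1 - c') :
    PercolationContinuityZ3 :=
  percolationContinuity_of_slabCrossings hc' ha h

end Summit.CriticalPhenomena.PercolationContinuityZ3.Theorems
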